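import Mathlib
import Summits.Ventures.PercRepro2.TypedBasesStar

/-!
# Class sums of typed counts: the one-edge split and the copy permutations (blind cell PercRepro2,
typer-1 g44, 2026-08-27; the API of `TypedBasesStar.typedClassCount` for night-3 g15's (TRI-o))

* `typedClassCount_insert`: the class of a colouring of `S` is the sum of its refinements by the
  colouring of one more edge `e ∉ S` (eight terms, three of them non-empty when `τ e ∈ {1, 2}`) —
  the induction step from the o-star classes down to the typed count.
* Permuting the copies of the kernel permutes the colours of the class
  (`typedClassCount_swap12/23/13`, `typedClassCount_cyc/cyc'`; the typed-triple condition is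
  symmetric in the copies, no type hypothesis needed), so the class sum of the symmetrised kernel
  is the average of the raw class sums over the six colour permutations
  (`typedClassCount_symKer`) — night-3's remark that the raw class sums are not colour-symmetric
  while `K^sym`'s are their average.  Own work; standard axioms.
-/

namespace Summit.Ventures.PercRepro2

namespace CovForm

/-! ## The one-edge split -/

section Split

variable {E : Type*} [Fintype E] [DecidableEq E] {R : Type*} [Field R]

omit [Fintype E] in
/-- Agreement on `insert e S` with the colouring updated at `e` is agreement at `e` and on `S`. -/
lemma agree_insert_iff {S : Finset E} {e : E} (he : e ∉ S) (x y w x₀ y₀ w₀ : Config E)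
    (a b c : Bool) :
    (∀ e' ∈ insert e S, x e' = Function.update x₀ e a e' ∧ y e' = Function.update y₀ e b e' ∧
        w e' = Function.update w₀ e c e') ↔
      (x e = a ∧ y e = b ∧ w e = c) ∧ (∀ e' ∈ S, x e' = x₀ e' ∧ y e' = y₀ e' ∧ w e' = w₀ e') := by
  constructor
  · intro h
    refine ⟨?_, fun e' he' => ?_⟩
    · have := h e (Finset.mem_insert_self e S)
      simpa only [Function.update_self] using this
    · have hne : e' ≠ e := fun h' => he (h' ▸ he')
      have := h e' (Finset.mem_insert_of_mem he')
      simpa only [Function.update_of_ne hne] using this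
  · rintro ⟨⟨hx, hy, hw⟩, hS⟩ e' he'
    rcases Finset.mem_insert.1 he' with rfl | he'
    · simp only [Function.update_self]; exact ⟨hx, hy, hw⟩
    · have hne : e' ≠ e := fun h' => he (h' ▸ he')
      simp only [Function.update_of_ne hne]; exact hS e' he'

/-- **The one-edge split**: the class of a colouring of `S` is the sum of its eight refinements by
the colouring of one more edge `e ∉ S` (three of them non-empty when `τ e ∈ {1, 2}`). -/
theorem typedClassCount_insert (F : Finset E) (z : Config E) (τ : E → ℕ) (S : Finset E) (e : E)
    (he : e ∉ S) (x₀ y₀ w₀ : Config E) (K : Config E → Config E → Config E → R) :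
    typedClassCount F z τ S x₀ y₀ w₀ K =
      ∑ a : Bool, ∑ b : Bool, ∑ c : Bool,
        typedClassCount F z τ (insert e S) (Function.update x₀ e a) (Function.update y₀ e b)
          (Function.update w₀ e c) K := by
  unfold typedClassCount
  rw [sum3_comm]
  refine Finset.sum_congr rfl fun x _ => Finset.sum_congr rfl fun y _ =>
    Finset.sum_congr rfl fun w _ => ?_
  simp only [agree_insert_iff he]
  by_cases hT : (∀ e, e ∉ F → x e = z e ∧ y e = z e ∧ w e = z e) ∧
      (∀ e ∈ F, openCount x y w e = τ e)
  · by_cases hA : ∀ e' ∈ S, x e' = x₀ e' ∧ y e' = y₀ e' ∧ w e' = w₀ e'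
    · have hall : ((∀ e, e ∉ F → x e = z e ∧ y e = z e ∧ w e = z e) ∧
          (∀ e ∈ F, openCount x y w e = τ e)) ∧
          (∀ e' ∈ S, x e' = x₀ e' ∧ y e' = y₀ e' ∧ w e' = w₀ e') := ⟨hT, hA⟩
      rw [if_pos hall]
      simp only [eq_true hT, eq_true hA, true_and, and_true]
      simp only [Fintype.sum_bool]
      cases x e <;> cases y e <;> cases w e <;> simp
    · have hall : ¬ (((∀ e, e ∉ F → x e = z e ∧ y e = z e ∧ w e = z e) ∧
          (∀ e ∈ F, openCount x y w e = τ e)) ∧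
          (∀ e' ∈ S, x e' = x₀ e' ∧ y e' = y₀ e' ∧ w e' = w₀ e')) := fun h => hA h.2
      rw [if_neg hall]
      symm
      refine Finset.sum_eq_zero fun a _ => Finset.sum_eq_zero fun b _ =>
        Finset.sum_eq_zero fun c _ => ?_
      rw [if_neg]
      exact fun h => hA h.2.2
  · have hall : ¬ (((∀ e, e ∉ F → x e = z e ∧ y e = z e ∧ w e = z e) ∧
        (∀ e ∈ F, openCount x y w e = τ e)) ∧
        (∀ e' ∈ S, x e' = x₀ e' ∧ y e' = y₀ e' ∧ w e' = w₀ e')) := fun h => hT h.1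
    rw [if_neg hall]
    symm
    refine Finset.sum_eq_zero fun a _ => Finset.sum_eq_zero fun b _ =>
      Finset.sum_eq_zero fun c _ => ?_
    rw [if_neg]
    exact fun h => hT h.1

end Split

/-! ## Class sums under the copy permutations -/

section ClassPerm

variable {E : Type*} [Fintype E] [DecidableEq E] {R : Type*} [Field R]

omit [Fintype E] [DecidableEq E] in
/-- The typed-triple condition is symmetric in the last two copies. -/
lemma cond_swap23 (F : Finset E) (z : Config E) (τ : E → ℕ) (x y w : Config E) :
    ((∀ e, e ∉ F → x e = z e ∧ w e = z e ∧ y e = z e) ∧ (∀ e ∈ F, openCount x w y e = τ e)) ↔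
      ((∀ e, e ∉ F → x e = z e ∧ y e = z e ∧ w e = z e) ∧ (∀ e ∈ F, openCount x y w e = τ e)) := by
  simp only [openCount]
  constructor
  · rintro ⟨h1, h2⟩
    exact ⟨fun e he => ⟨(h1 e he).1, (h1 e he).2.2, (h1 e he).2.1⟩,
      fun e he => by rw [← h2 e he]; ring⟩
  · rintro ⟨h1, h2⟩
    exact ⟨fun e he => ⟨(h1 e he).1, (h1 e he).2.2, (h1 e he).2.1⟩,
      fun e he => by rw [← h2 e he]; ring⟩

omit [Fintype E] [DecidableEq E] in
/-- Agreement on `S` after exchanging the first two copies. -/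
lemma agree_swap12 (S : Finset E) (x y w x₀ y₀ w₀ : Config E) :
    (∀ e ∈ S, y e = x₀ e ∧ x e = y₀ e ∧ w e = w₀ e) ↔
      (∀ e ∈ S, x e = y₀ e ∧ y e = x₀ e ∧ w e = w₀ e) := by
  constructor <;> intro h e he <;> obtain ⟨h1, h2, h3⟩ := h e he <;> exact ⟨h2, h1, h3⟩

omit [Fintype E] [DecidableEq E] in
/-- Agreement on `S` after exchanging the last two copies. -/
lemma agree_swap23 (S : Finset E) (x y w x₀ y₀ w₀ : Config E) :
    (∀ e ∈ S, x e = x₀ e ∧ w e = y₀ e ∧ y e = w₀ e) ↔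
      (∀ e ∈ S, x e = x₀ e ∧ y e = w₀ e ∧ w e = y₀ e) := by
  constructor <;> intro h e he <;> obtain ⟨h1, h2, h3⟩ := h e he <;> exact ⟨h1, h3, h2⟩

/-- Exchanging the first two copies of the kernel exchanges the first two colours of the class. -/
lemma typedClassCount_swap12 (F : Finset E) (z : Config E) (τ : E → ℕ) (S : Finset E)
    (x₀ y₀ w₀ : Config E) (K : Config E → Config E → Config E → R) :
    typedClassCount F z τ S x₀ y₀ w₀ (fun x y w => K y x w) =
      typedClassCount F z τ S y₀ x₀ w₀ K := by
  unfold typedClassCount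
  rw [Finset.sum_comm]
  refine Finset.sum_congr rfl fun x _ => Finset.sum_congr rfl fun y _ =>
    Finset.sum_congr rfl fun w _ => ?_
  exact if_congr (and_congr (TypedA3.cond_swap12 F z τ y x w) (agree_swap12 S x y w x₀ y₀ w₀))
    rfl rfl

/-- Exchanging the last two copies of the kernel exchanges the last two colours of the class. -/
lemma typedClassCount_swap23 (F : Finset E) (z : Config E) (τ : E → ℕ) (S : Finset E)
    (x₀ y₀ w₀ : Config E) (K : Config E → Config E → Config E → R) :
    typedClassCount F z τ S x₀ y₀ w₀ (fun x y w => K x w y) =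
      typedClassCount F z τ S x₀ w₀ y₀ K := by
  unfold typedClassCount
  refine Finset.sum_congr rfl fun x _ => ?_
  rw [Finset.sum_comm]
  refine Finset.sum_congr rfl fun y _ => Finset.sum_congr rfl fun w _ => ?_
  exact if_congr (and_congr (cond_swap23 F z τ x y w) (agree_swap23 S x y w x₀ y₀ w₀)) rfl rfl

/-- Exchanging the first and third copies of the kernel exchanges the first and third colours. -/
lemma typedClassCount_swap13 (F : Finset E) (z : Config E) (τ : E → ℕ) (S : Finset E)
    (x₀ y₀ w₀ : Config E) (K : Config E → Config E → Config E → R) :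
    typedClassCount F z τ S x₀ y₀ w₀ (fun x y w => K w y x) =
      typedClassCount F z τ S w₀ y₀ x₀ K := by
  have h1 := typedClassCount_swap12 F z τ S x₀ y₀ w₀ (fun x y w => K w x y)
  have h2 := typedClassCount_swap23 F z τ S y₀ x₀ w₀ (fun x y w => K y x w)
  have h3 := typedClassCount_swap12 F z τ S y₀ w₀ x₀ K
  exact h1.trans (h2.trans h3)

/-- The copy 3-cycle `(x, y, w) ↦ (y, w, x)` on the kernel cycles the colours of the class. -/
lemma typedClassCount_cyc (F : Finset E) (z : Config E) (τ : E → ℕ) (S : Finset E)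
    (x₀ y₀ w₀ : Config E) (K : Config E → Config E → Config E → R) :
    typedClassCount F z τ S x₀ y₀ w₀ (fun x y w => K y w x) =
      typedClassCount F z τ S y₀ w₀ x₀ K := by
  have h1 := typedClassCount_swap12 F z τ S x₀ y₀ w₀ (fun x y w => K x w y)
  have h2 := typedClassCount_swap23 F z τ S y₀ x₀ w₀ K
  exact h1.trans h2

/-- The copy 3-cycle `(x, y, w) ↦ (w, x, y)` on the kernel cycles the colours of the class. -/
lemma typedClassCount_cyc' (F : Finset E) (z : Config E) (τ : E → ℕ) (S : Finset E)
    (x₀ y₀ w₀ : Config E) (K : Config E → Config E → Config E → R) :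
    typedClassCount F z τ S x₀ y₀ w₀ (fun x y w => K w x y) =
      typedClassCount F z τ S w₀ x₀ y₀ K := by
  have h1 := typedClassCount_swap23 F z τ S x₀ y₀ w₀ (fun x y w => K y x w)
  have h2 := typedClassCount_swap12 F z τ S x₀ w₀ y₀ K
  exact h1.trans h2

/-- The class sum of a constant multiple of a kernel. -/
lemma typedClassCount_const_mul (F : Finset E) (z : Config E) (τ : E → ℕ) (S : Finset E)
    (x₀ y₀ w₀ : Config E) (c : R) (K : Config E → Config E → Config E → R) :
    typedClassCount F z τ S x₀ y₀ w₀ (fun x y w => c * K x y w) =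
      c * typedClassCount F z τ S x₀ y₀ w₀ K := by
  unfold typedClassCount
  simp only [Finset.mul_sum]
  refine Finset.sum_congr rfl fun x _ => Finset.sum_congr rfl fun y _ =>
    Finset.sum_congr rfl fun w _ => ?_
  split_ifs <;> simp

/-- The class sum of a sum of six kernels. -/
lemma typedClassCount_sum6 (F : Finset E) (z : Config E) (τ : E → ℕ) (S : Finset E)
    (x₀ y₀ w₀ : Config E) (K₁ K₂ K₃ K₄ K₅ K₆ : Config E → Config E → Config E → R) :
    typedClassCount F z τ S x₀ y₀ w₀ (fun x y w =>
        K₁ x y w + K₂ x y w + K₃ x y w + K₄ x y w + K₅ x y w + K₆ x y w) =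
      typedClassCount F z τ S x₀ y₀ w₀ K₁ + typedClassCount F z τ S x₀ y₀ w₀ K₂ +
        typedClassCount F z τ S x₀ y₀ w₀ K₃ + typedClassCount F z τ S x₀ y₀ w₀ K₄ +
        typedClassCount F z τ S x₀ y₀ w₀ K₅ + typedClassCount F z τ S x₀ y₀ w₀ K₆ := by
  unfold typedClassCount
  simp only [← Finset.sum_add_distrib]
  refine Finset.sum_congr rfl fun x _ => Finset.sum_congr rfl fun y _ =>
    Finset.sum_congr rfl fun w _ => ?_
  split_ifs <;> simp

/-- **The class sum of the symmetrised kernel is the average of the raw class sums over the six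
colour permutations** of the class (night-3 g15's remark: the raw class sums are not
colour-symmetric, the symmetrised one is their average). -/
theorem typedClassCount_symKer (F : Finset E) (z : Config E) (τ : E → ℕ) (S : Finset E)
    (x₀ y₀ w₀ : Config E) (K : Config E → Config E → Config E → R) :
    typedClassCount F z τ S x₀ y₀ w₀ (symKer K) =
      (6 : R)⁻¹ * (typedClassCount F z τ S x₀ y₀ w₀ K + typedClassCount F z τ S x₀ w₀ y₀ K +
        typedClassCount F z τ S y₀ x₀ w₀ K + typedClassCount F z τ S y₀ w₀ x₀ K +
        typedClassCount F z τ S w₀ x₀ y₀ K + typedClassCount F z τ S w₀ y₀ x₀ K) := by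
  have hs : typedClassCount F z τ S x₀ y₀ w₀ (symKer K) = typedClassCount F z τ S x₀ y₀ w₀
      (fun x y w => (6 : R)⁻¹ * (K x y w + K x w y + K y x w + K y w x + K w x y + K w y x)) :=
    rfl
  rw [hs, typedClassCount_const_mul, typedClassCount_sum6 F z τ S x₀ y₀ w₀ K (fun x y w => K x w y)
    (fun x y w => K y x w) (fun x y w => K y w x) (fun x y w => K w x y) (fun x y w => K w y x),
    typedClassCount_swap23 F z τ S x₀ y₀ w₀ K, typedClassCount_swap12 F z τ S x₀ y₀ w₀ K,
    typedClassCount_cyc F z τ S x₀ y₀ w₀ K, typedClassCount_cyc' F z τ S x₀ y₀ w₀ K,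
    typedClassCount_swap13 F z τ S x₀ y₀ w₀ K]

end ClassPerm

end CovForm

end Summit.Ventures.PercRepro2
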